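import Literature.MathematicalPhysics.QuantumFieldTheory.Balaban1983to89.B6MultiLevelBoxOperatorL0
import Literature.MathematicalPhysics.QuantumFieldTheory.Balaban1983to89.B6MultiLevelTorusOperator

/-!
# `Balaban1983to89.B6MultiLevelTorusOperatorL0` — [B6] (2.1)–(2.4), (2.13)–(2.14) ON THE TORUS `T_η` WITH THE LEVEL `0` ADMITTED:
the nested family `T_η ⊃ Ω₁ ⊃ … ⊃ Ω_k` with print's region `Λ₀ = T_η ∖ Ω₁` (possibly non-empty), the entries of the GENUINE `k`-level
operator `Δ′_a = −Δ^{per} + Σ_{j=0}^{k} a_j(L^jη)^{−2}Q′_j*1_{Λ_j}Q′_j` for it and the translation charts (file F2 = print section S-A of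
the level-0 programme G-F3′-L0; the twin of `B6MultiLevelTorusOperator` §4–§6 with the SAME declaration names; every `D`-free object
— translations, `−Δ^{per}`, the seam, `mlOpT`, `gmlT`, injectivity, forms — is the lineage's, consumed BY NAME; no existing module is
touched; no fact is minted)

FRAMING (verbatim cell line):
statement-level skeleton of published theorems with citation tags; proofs where landed; nothing here is a claim about the Yang–Mills mass gap

Source under audit (cell lit-balaban): T. Bałaban, *Propagators and renormalization transformations for lattice gauge theories. II*,
Commun. Math. Phys. **96** (1984) 223–250 [`Balaban1984PropagatorsII`, "B6"], p. 224 [PDF 2] (2.1)–(2.4), p. 225 [PDF 3] (2.13)–(2.14),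
p. 229 [PDF 7] (the boundary-condition paragraph) — held text `paper:balaban1984-cmp96-propagators-rt-ii` re-read this generation; T. Bałaban,
*Regularity and decay of lattice Green's functions*, Commun. Math. Phys. **89** (1983) 571–597 [`Balaban1983RegularityDecay`], p. 572 (the
torus sentence).  Unit `lit-balaban-r03` (B6 fold owner, r03 gen 36), HOME `run/shared/lean/pub/lit-balaban/`, programme G-F3′-L0 = director-ym
LINE №27 / UV3-NODE §24.5, plan `lit-balaban-r03/G-F3L0-PLAN.md`; referee ref-4.

## WHAT IS PRINTED (verbatim up to notation)

p. 224: «We consider a sequence of domains Ω₁ ⊃ Ω₂ ⊃ … ⊃ Ω_k, Ω_j ⊂ T_η, j = 1, 2, …, k, (2.1) … Λ₀ = Ω₁^c (2.3) … T = ⋃_{j=0}^{k} B^j(Λ_j),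
where B⁰(Λ₀) = Λ₀. (2.4)».  p. 225: «⟨λ, Q′*aQ′λ⟩ = Σ_{j=0}^{k} Σ_{y∈Λ_j} a_j(L^jη)^{d−2}|(Q′_jλ)(y)|². (2.14) … we assume that (Q′₀λ)(x) =
λ(x), x ∈ Λ₀ … with min{a_j, π²} instead of π² and the index j running from 0 to k».  p. 229: «taking a sequence (2.1) with Ω = Ω_k and
smallest possible domains B^j(Λ_j), and considering the operator Δ_a defined by (2.19), (2.20) for this sequence … an effective mass …
starting from O(1) on Ω_k up to +∞ outside Ω₁.»  [3] p. 572: «a torus T_η which we identify with a rectangular parallelepiped in ηZ^d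
with periodic conditions.»

## WHAT THIS FILE CERTIFIES (kernel-checked; lattice units of the lineage, `η = 1`)

* `TDomains` — **(2.1)–(2.2) ON THE TORUS WITH LEVELS `0, …, k`**: the level function (`lev ≤ k`, no floor: `Λ₀ = {lev = 0}`), (2.1) big
  blocks for every `j ≥ 1` (a condition on `Ω₁` too), **(2.2) with the TORUS sup-distance** verbatim; `toDomains` (a torus family IS a box
  family of the fundamental box for the level-0 box structure `B6MultiLevelBoxOperatorL0.Domains` — `dist_T ≤ dist_X`), `ofTorus` (every
  family of the twin structure is one of this structure), `top`, `floor` (`Λ₀ = T_η`), and **the charts** (translation vectors `tvec` of the lineage) `D.chart s` (the family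
  translated by `(M·L^k)·s` is again a torus family; `chart_lev`, `chart_zero_lev`), `lev_eq_of_blk_eq`;
* **`mlOpT_apply`** — the entries of the lineage's torus operator `B6MultiLevelTorusOperator.mlOpT` (REUSED: it already sums `j = 0, …, k`
  over a bare level function; its inverse `gmlT`, injectivity `mlOpT_mulVec_injective`, forms and positivity need only `lev ≤ k` and are
  consumed by name) for a family of this structure: `Δ′_a(x, x′) = (−Δ^{per})(x, x′) + levC_{lev x}·[x′ ∼_{lev x} x]`, and the level-`0`
  rows **`mlOpT_apply_of_lev_zero`**: `(−Δ^{per})(x, x′) + a₀·δ_{xx′}` on `Λ₀`;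
* §6 **THE CHART IDENTITY** for the new structure: `mlOpT_tshift`, `mlOpT_eq_reindex_chart`
  (`Δ′_a^{torus} = σ_s ∘ (Δ′_a^{box}[(D.chart s).toDomains] + seamT) ∘ σ_s⁻¹`), `mlOpT_mul_reindex` — the device by which the files to
  follow transport cube terms and bounds from the box lineage to the torus, one chart per cube, now with level-`0` cubes admitted.

## HONEST SCOPE

* The torus has the side lengths `N₀_μ = (M·L^k)·P_μ` of the lineage's box; levels `0 … k`; `A = 0`; `m² = 0`; the weights `a_j`, `a₀`
  included, are free positive parameters (finite lattice-scale mass at level `0`, exactly as (2.14)/(2.20) print it — no Dirichlet rows).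
* `dist` of (2.2) in the sup-distance of the torus `Π_μ ℤ/N₀_μ`; big blocks of level `j` = cubes of the grid `(M·L^j)ℤ^{d+1}` reduced
  modulo `N₀`; at level `0` they have side `M`.
* This file proves no inequality of Prop. 2.2; it sets up the level-0 carrier on the torus.  Nothing is inferred from the manuscript.
  Value = layer-1 twin of the level-0 port (plan Appendix A); NOT summit progress.
-/

namespace Literature.MathematicalPhysics.QuantumFieldTheory.Balaban1983to89.B6MultiLevelTorusOperatorL0

open Finset Matrix
open Literature.MathematicalPhysics.QuantumFieldTheory.Balaban1983to89.B4ContourShift (supNorm abs_le_supNorm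
  supNorm_nonneg exists_supNorm_eq)
open Literature.MathematicalPhysics.QuantumFieldTheory.Balaban1983to89.B4Reflection242 (boxDom mem_boxDom nbrs mem_nbrs
  blk neumannLapK diagK avgK card_nbrs not_mem_nbrs_self)
open Literature.MathematicalPhysics.QuantumFieldTheory.Balaban1983to89.B4Green242Bridge (boxNbrs zero_mem_boxDom
  box_const_of_bonds mem_boxNbrs_comm not_mem_boxNbrs_self card_boxNbrs)
open Literature.MathematicalPhysics.QuantumFieldTheory.Balaban1983to89.B4BoxCov237 (opBoxR opBoxR_isSymm quadFormR_eq)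
open Literature.MathematicalPhysics.QuantumFieldTheory.Balaban1983to89.B4TorusKernel.MultiPeriod (torusSupNorm translate
  torusSupNorm_le_supNorm torusSupNorm_translate translate_apply)
open Literature.MathematicalPhysics.QuantumFieldTheory.Balaban1983to89.B4Lemma24ZeroBoxAlphaNeg (blk_one)
open Literature.MathematicalPhysics.QuantumFieldTheory.Balaban1983to89.B6MultiLevelBoxOperator (N0 bigSide bigSide_eq
  bigSide_succ_eq bigSide_succ one_le_bigSide levC levC_pos indLev mlOp gml)
open Literature.MathematicalPhysics.QuantumFieldTheory.Balaban1983to89.B6MultiLevelBoxOperatorL0 (Domains levC_zero mlOp_apply)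
open Literature.MathematicalPhysics.QuantumFieldTheory.Balaban1983to89.B6MultiLevelTorusOperator (twrap twrap_mem twrap_eq_self
  twrap_twrap_add tshift tshift_val tshift_val_of_mem tshift_tshift tshift_zero torusSupNorm_tshift_sub one_le_of_mem unitVec perLapT
  perLapT_tshift seamT seamT_mul_eq_zero Interior blk_twrap_add_eq blk_tshift_eq_iff N0_eq_bigSide_mul one_le_N0 mlOpT opBoxR_lap_apply)

noncomputable section

variable {d : ℕ}

/-! ## §4 (2.1)–(2.4) on the torus `T_η` with the level `0` -/

/-- **(2.1)–(2.2) ON THE TORUS `T_η` WITH LEVELS `0, …, k`** (`Λ₀ = T_η ∖ Ω₁` admitted — print p. 229 «smallest possible domains B^j(Λ_j)»):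
the LEVEL FUNCTION `lev` on the fundamental box `Π_μ[0, N₀_μ)` of the torus (`x ∈ B^j(Λ_j) ⇔ lev x = j`, (2.3)–(2.4) built in, `B⁰(Λ₀) = Λ₀`),
**(2.1)** «Ω_j^{(j)} is a sum of big blocks» for every `1 ≤ j` (membership in `Ω_j = {j ≤ lev}` depends only on the big `j`-block, a block of
the torus since `M·L^j ∣ N₀`), **(2.2)** «(L^jη)^{−1}dist(Ω_j^c, Ω_{j+1}) > RM» with the distance of the TORUS (`torusSupNorm`).
[cite: Balaban1984PropagatorsII, (2.1)–(2.4) p.224 with p.229] -/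
structure TDomains (d ℓ Mh k : ℕ) (P : Fin (d + 1) → ℕ) (R : ℕ) where
  /-- the level of (the territory `B^j(Λ_j)` containing) a site of the torus; `0` on `Λ₀ = T_η ∖ Ω₁` -/
  lev : (Fin (d + 1) → ℤ) → ℕ
  lev_le : ∀ x, lev x ≤ k
  /-- (2.1): `Ω_j = {j ≤ lev}` is a union of big `j`-blocks, `1 ≤ j` -/
  bigBlocks : ∀ j, 1 ≤ j → ∀ x ∈ boxDom (N0 ℓ Mh k P), ∀ x' ∈ boxDom (N0 ℓ Mh k P),
    blk (bigSide ℓ Mh j) x' = blk (bigSide ℓ Mh j) x → (j ≤ lev x ↔ j ≤ lev x')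
  /-- (2.2) with the torus distance: `dist_T(Ω_j^c, Ω_{j+1}) > R·M·L^j` -/
  sepT : ∀ j, ∀ x ∈ boxDom (N0 ℓ Mh k P), ∀ x' ∈ boxDom (N0 ℓ Mh k P), lev x < j → j + 1 ≤ lev x' →
    ((R * bigSide ℓ Mh j : ℕ) : ℝ) < torusSupNorm (N0 ℓ Mh k P) (x - x')

namespace TDomains

variable {ℓ Mh k R : ℕ} {P : Fin (d + 1) → ℕ} (D : TDomains d ℓ Mh k P R)

/-- **A TORUS FAMILY IS A BOX FAMILY OF THE FUNDAMENTAL BOX** (same level function; the level-0 box structure of file F1): the torus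
distance is at most the lattice distance of the representatives, so (2.2) on the torus implies (2.2) on the box — every theorem of the
level-0 box lineage applies to `D.toDomains`. [cite: Balaban1984PropagatorsII, (2.1)–(2.2) p.224, dictionary] -/
def toDomains : Domains d ℓ Mh k P R where
  lev := D.lev
  lev_le := D.lev_le
  bigBlocks := D.bigBlocks
  sep := fun j x hx x' hx' h1 h2 =>
    lt_of_lt_of_le (D.sepT j x hx x' hx' h1 h2) (torusSupNorm_le_supNorm (one_le_of_mem hx) _)

/-- the level function of the box family is the torus level function. [cite: Balaban1984PropagatorsII, (2.3)–(2.4) p.224] -/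
@[simp] theorem toDomains_lev : (TDomains.toDomains D).lev = TDomains.lev D := rfl

/-- **EVERY TORUS FAMILY OF THE TWIN STRUCTURE IS ONE OF THIS STRUCTURE** (same level function; its `Λ₀` is empty): print's admitted case
«Ω_j = T_η for j = 1, …, l» inside the general one. [cite: Balaban1984PropagatorsII, (2.1) p.224 («we admit the case when some domains Ω_j are equal to T_η»)] -/
def ofTorus (D₁ : B6MultiLevelTorusOperator.TDomains d ℓ Mh k P R) : TDomains d ℓ Mh k P R where
  lev := D₁.lev
  lev_le := D₁.lev_le
  bigBlocks := fun j hj x hx x' hx' h => by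
    rcases Nat.lt_or_ge 1 j with hlt | hle
    · exact D₁.bigBlocks j hlt x hx x' hx' h
    · have hj1 : j = 1 := le_antisymm hle hj
      subst hj1
      exact ⟨fun _ => D₁.one_le_lev x', fun _ => D₁.one_le_lev x⟩
  sepT := D₁.sepT

/-- the embedding keeps the level function. [cite: Balaban1984PropagatorsII, (2.3)–(2.4) p.224] -/
@[simp] theorem ofTorus_lev (D₁ : B6MultiLevelTorusOperator.TDomains d ℓ Mh k P R) : (ofTorus D₁).lev = D₁.lev := rfl

/-- the two embeddings commute: the box family of an embedded torus family is the embedded box family of the twin's box family (same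
level function). [cite: Balaban1984PropagatorsII, (2.1)–(2.4) p.224, dictionary] -/
theorem toDomains_ofTorus_lev (D₁ : B6MultiLevelTorusOperator.TDomains d ℓ Mh k P R) :
    (ofTorus D₁).toDomains.lev = (Domains.ofBox D₁.toDomains).lev := rfl

/-- **THE TRIVIAL MEMBER** `Ω₁ = … = Ω_k = T_η`: the structure is inhabited (`k = 0` included). [cite: Balaban1984PropagatorsII, (2.1) p.224 («Ω_j = T_η for j = 1, 2, …»)] -/
def top (d ℓ Mh k : ℕ) (P : Fin (d + 1) → ℕ) (R : ℕ) : TDomains d ℓ Mh k P R where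
  lev := fun _ => k
  lev_le := fun _ => le_rfl
  bigBlocks := fun _ _ _ _ _ _ _ => Iff.rfl
  sepT := fun j x _ x' _ (h1 : k < j) (h2 : j + 1 ≤ k) => by exfalso; omega

/-- **THE FLOOR MEMBER** `Ω₁ = ∅`, `Λ₀ = T_η`: the pure lattice-scale mass `−Δ^{per} + a₀`. [cite: Balaban1984PropagatorsII, (2.3)–(2.4) p.224 («Λ₀ = Ω₁^c»), p.229] -/
def floor (d ℓ Mh k : ℕ) (P : Fin (d + 1) → ℕ) (R : ℕ) : TDomains d ℓ Mh k P R where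
  lev := fun _ => 0
  lev_le := fun _ => Nat.zero_le _
  bigBlocks := fun _ _ _ _ _ _ _ => Iff.rfl
  sepT := fun j x _ x' _ (h1 : 0 < j) (h2 : j + 1 ≤ 0) => by exfalso; omega

/-- **THE CHART `s`** (a torus translation by `(M·L^k)·s`): the translated level function `x ↦ lev((x + (M·L^k)s) mod N₀)` is again a torus
family with level `0` — big blocks go to big blocks (every `j ≥ 1`), torus distances are preserved. [cite: Balaban1984PropagatorsII, (2.1)–(2.2) p.224, dictionary] -/
def chart (s : Fin (d + 1) → ℤ) : TDomains d ℓ Mh k P R where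
  lev := fun x => D.lev (twrap (N0 ℓ Mh k P) (x + B6MultiLevelTorusOperator.TDomains.tvec ℓ Mh k s))
  lev_le := fun _ => D.lev_le _
  bigBlocks := by
    intro j hj x hx x' hx' hblk
    by_cases hjk : j ≤ k
    · have hN1 : ∀ i, 1 ≤ N0 ℓ Mh k P i := fun i => one_le_of_mem hx i
      obtain ⟨c, hc⟩ := B6MultiLevelTorusOperator.TDomains.bigSide_dvd (ℓ := ℓ) (Mh := Mh) hjk
      have hb : 1 ≤ bigSide ℓ Mh j := by
        have := hN1 0; rw [N0_eq_bigSide_mul, hc] at this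
        exact Nat.one_le_iff_ne_zero.2 fun h => by rw [h] at this; simp at this
      have hνpos : ∀ i, 1 ≤ c * P i := fun i => by
        have := hN1 i; rw [N0_eq_bigSide_mul, hc, mul_assoc] at this
        exact Nat.one_le_iff_ne_zero.2 fun h => by rw [h] at this; simp at this
      have key := blk_twrap_add_eq hb (N := N0 ℓ Mh k P) (ν := fun i => c * P i)
        (fun i => by rw [N0_eq_bigSide_mul, hc, mul_assoc]) hνpos (t := B6MultiLevelTorusOperator.TDomains.tvec ℓ Mh k s)
        (τ := fun i => (c : ℤ) * s i) (fun i => by simp only [B6MultiLevelTorusOperator.TDomains.tvec, hc]; push_cast; ring) hblk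
      exact D.bigBlocks j hj _ (twrap_mem hN1 _) _ (twrap_mem hN1 _) key
    · constructor <;> intro h
      · exact absurd (h.trans (D.lev_le _)) hjk
      · exact absurd (h.trans (D.lev_le _)) hjk
  sepT := by
    intro j x hx x' hx' h1 h2
    have hN1 : ∀ i, 1 ≤ N0 ℓ Mh k P i := fun i => one_le_of_mem hx i
    have h := D.sepT j _ (twrap_mem hN1 (x + B6MultiLevelTorusOperator.TDomains.tvec ℓ Mh k s)) _
      (twrap_mem hN1 (x' + B6MultiLevelTorusOperator.TDomains.tvec ℓ Mh k s)) h1 h2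
    have e := torusSupNorm_tshift_sub (N0 ℓ Mh k P) (B6MultiLevelTorusOperator.TDomains.tvec ℓ Mh k s) ⟨x, hx⟩ ⟨x', hx'⟩
    rw [tshift_val, tshift_val] at e
    rwa [e] at h

/-- the chart's level at `x` is the level at the translated site `σ_s x`. [cite: Balaban1984PropagatorsII, (2.3)–(2.4) p.224, dictionary] -/
theorem chart_lev (s : Fin (d + 1) → ℤ) (x : ↥(boxDom (N0 ℓ Mh k P))) :
    (D.chart s).lev x.1 = D.lev (tshift (N0 ℓ Mh k P) (B6MultiLevelTorusOperator.TDomains.tvec ℓ Mh k s) x).1 := rfl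

/-- the chart `0` has the original level function on the box. [cite: Balaban1984PropagatorsII, (2.3)–(2.4) p.224, dictionary] -/
theorem chart_zero_lev (x : ↥(boxDom (N0 ℓ Mh k P))) : (TDomains.chart D 0).lev x.1 = TDomains.lev D x.1 := by
  rw [chart_lev]
  have : B6MultiLevelTorusOperator.TDomains.tvec ℓ Mh k (0 : Fin (d + 1) → ℤ) = 0 := funext fun i => by
    simp [B6MultiLevelTorusOperator.TDomains.tvec]
  rw [this, tshift_zero]

/-- the chart of an embedded family is the embedded chart (same level function). [cite: Balaban1984PropagatorsII, (2.1)–(2.4) p.224, dictionary] -/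
theorem chart_ofTorus_lev (D₁ : B6MultiLevelTorusOperator.TDomains d ℓ Mh k P R) (s : Fin (d + 1) → ℤ) :
    ((ofTorus D₁).chart s).lev = (D₁.chart s).lev := rfl

/-- two sites of the torus in one `L^{lev x}`-block have the same level (territories are unions of blocks of their own level, `Λ₀`
included; inherited from the level-0 box lineage). [cite: Balaban1984PropagatorsII, (2.1)+(2.3) p.224] -/
theorem lev_eq_of_blk_eq {x x' : Fin (d + 1) → ℤ} (hx : x ∈ boxDom (N0 ℓ Mh k P)) (hx' : x' ∈ boxDom (N0 ℓ Mh k P))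
    (h : blk ((ℓ + 1) ^ D.lev x) x' = blk ((ℓ + 1) ^ D.lev x) x) : TDomains.lev D x' = TDomains.lev D x :=
  D.toDomains.lev_eq_of_blk_eq hx hx' h

/-- the two-level window on the torus box (inherited): for `R ≥ 2L`, a site within `< 2ML^j` (LATTICE sup-distance of representatives) of a
site of `B^j(Λ_j)` has level `j − 1`, `j` or `j + 1` (`0` or `1` when `j = 0`). [cite: Balaban1984PropagatorsII, (2.2) p.224 with p.230] -/
theorem lev_window (hR : 2 * (ℓ + 1) ≤ R) {t x : Fin (d + 1) → ℤ} (ht : t ∈ boxDom (N0 ℓ Mh k P))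
    (hx : x ∈ boxDom (N0 ℓ Mh k P)) {j : ℕ} (htj : D.lev t = j)
    (hxt : supNorm (x - t) < 2 * (bigSide ℓ Mh j : ℝ)) : j ≤ TDomains.lev D x + 1 ∧ TDomains.lev D x ≤ j + 1 :=
  D.toDomains.lev_window hR ht hx htj hxt

end TDomains

/-! ## §5 The entries of the `k`-level operator `Δ′_a` (2.13)–(2.14) ON THE TORUS for a family with level `0` -/

section Apply

variable {ℓ Mh k R : ℕ} {P : Fin (d + 1) → ℕ} (D : TDomains d ℓ Mh k P R)

/-- **ENTRIES OF `Δ′_a` ON THE TORUS** (the lineage's `B6MultiLevelTorusOperator.mlOpT`, reused) for a family with level `0`: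
`Δ′_a(x, x′) = (−Δ^{per})(x, x′) + levC_{lev x}·[x′ ∼_{lev x} x]`. [cite: Balaban1984PropagatorsII, (2.13)–(2.14) p.225] -/
theorem mlOpT_apply {N : Fin (d + 1) → ℕ} (hN : N = N0 ℓ Mh k P) (a : ℕ → ℝ) (x y : ↥(boxDom N)) :
    mlOpT N ℓ k D.lev a x y
      = perLapT N x y + avgK (levC d ℓ a (D.lev x.1)) ((ℓ + 1) ^ D.lev x.1) x.1 y.1 := by
  unfold mlOpT seamT
  rw [Matrix.add_apply, Matrix.sub_apply, ← D.toDomains_lev, mlOp_apply D.toDomains hN a x y, opBoxR_lap_apply]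
  ring

/-- **THE LEVEL-`0` ROWS OF `Δ′_a` ON THE TORUS**: for `x ∈ Λ₀`, `Δ′_a(x, x′) = (−Δ^{per})(x, x′) + a₀·δ_{xx′}` («(Q′₀λ)(x) = λ(x), x ∈ Λ₀»;
p. 229 «+∞ outside Ω₁» in the continuum reading of `a₀η^{−2}`). [cite: Balaban1984PropagatorsII, (2.14) p.225, p.229] -/
theorem mlOpT_apply_of_lev_zero {N : Fin (d + 1) → ℕ} (hN : N = N0 ℓ Mh k P) (a : ℕ → ℝ) (x y : ↥(boxDom N))
    (h0 : D.lev x.1 = 0) :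
    mlOpT N ℓ k D.lev a x y = perLapT N x y + (if y = x then a 0 else 0) := by
  rw [mlOpT_apply D hN a x y, h0, levC_zero, pow_zero]
  unfold avgK
  rw [blk_one, blk_one]
  by_cases hxy : y = x
  · rw [if_pos (congrArg Subtype.val hxy), if_pos hxy]
  · rw [if_neg (fun h => hxy (Subtype.ext h)), if_neg hxy]

/-- the hypothesis `lev ≤ k` under which the lineage's `gmlT` is the two-sided inverse of `Δ′_a` on the torus
(`B6MultiLevelTorusOperator.mlOpT_mul_gmlT`), read off the structure. [cite: Balaban1984PropagatorsII, p.225 («G′ = Δ′_a^{−1} is a well defined, positive operator»)] -/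
theorem lev_le_k : ∀ x, TDomains.lev D x ≤ k := D.lev_le

end Apply

/-! ## §6 The chart identity for families with level `0` -/

section Chart

variable {ℓ Mh k R : ℕ} {P : Fin (d + 1) → ℕ} (D : TDomains d ℓ Mh k P R)

/-- **`Δ′_a` ON THE TORUS IS TRANSLATION COVARIANT**: its entries at `(σ_s x, σ_s y)` are the entries at `(x, y)` of the torus operator of the
chart `s`. [cite: Balaban1984PropagatorsII, (2.13)–(2.14) p.225, dictionary] -/
theorem mlOpT_tshift (hMh : 1 ≤ Mh) (hP : ∀ i, 1 ≤ P i) (a : ℕ → ℝ) (s : Fin (d + 1) → ℤ)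
    (x y : ↥(boxDom (N0 ℓ Mh k P))) :
    mlOpT (N0 ℓ Mh k P) ℓ k D.lev a (tshift (N0 ℓ Mh k P) (B6MultiLevelTorusOperator.TDomains.tvec ℓ Mh k s) x)
        (tshift (N0 ℓ Mh k P) (B6MultiLevelTorusOperator.TDomains.tvec ℓ Mh k s) y)
      = mlOpT (N0 ℓ Mh k P) ℓ k (D.chart s).lev a x y := by
  rw [mlOpT_apply D rfl, mlOpT_apply (D.chart s) rfl, perLapT_tshift, ← D.chart_lev s x]
  congr 1
  unfold avgK
  have h := B6MultiLevelTorusOperator.blk_chart_iff hMh hP (le_trans ((D.chart s).lev_le x.1) (Nat.le_succ k)) s x y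
  by_cases hc : blk ((ℓ + 1) ^ (D.chart s).lev x.1) y.1 = blk ((ℓ + 1) ^ (D.chart s).lev x.1) x.1
  · rw [if_pos hc, if_pos (h.2 hc)]
  · rw [if_neg hc, if_neg (fun h' => hc (h.1 h'))]

/-- **THE CHART IDENTITY** (level `0` admitted): `Δ′_a` on the torus is the reindexing, along the torus translation `σ_s`, of the BOX
operator `Δ′_a^{box}` of the chart `s` plus the seam — so that every theorem of the level-0 box lineage about `Δ′_a^{box}` of the `Domains`
`(D.chart s).toDomains` is a statement about the torus operator away from the seam. [cite: Balaban1984PropagatorsII, (2.13)–(2.14) p.225, dictionary] -/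
theorem mlOpT_eq_reindex_chart (hMh : 1 ≤ Mh) (hP : ∀ i, 1 ≤ P i) (a : ℕ → ℝ) (s : Fin (d + 1) → ℤ) :
    mlOpT (N0 ℓ Mh k P) ℓ k D.lev a
      = Matrix.reindex (tshift (N0 ℓ Mh k P) (B6MultiLevelTorusOperator.TDomains.tvec ℓ Mh k s)) (tshift (N0 ℓ Mh k P) (B6MultiLevelTorusOperator.TDomains.tvec ℓ Mh k s))
          (mlOp (N0 ℓ Mh k P) ℓ k (D.chart s).toDomains.lev a + seamT (N0 ℓ Mh k P)) := by
  ext i j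
  rw [Matrix.reindex_apply, Matrix.submatrix_apply, TDomains.toDomains_lev]
  have h := mlOpT_tshift D hMh hP a s ((tshift (N0 ℓ Mh k P) (B6MultiLevelTorusOperator.TDomains.tvec ℓ Mh k s)).symm i)
    ((tshift (N0 ℓ Mh k P) (B6MultiLevelTorusOperator.TDomains.tvec ℓ Mh k s)).symm j)
  rw [Equiv.apply_symm_apply, Equiv.apply_symm_apply] at h
  rw [h]
  rfl

/-- **CONSEQUENCE FOR LOCAL TERMS** (level `0` admitted): if a matrix `A` (in the chart's coordinates) has vanishing wall rows, then
`Δ′_a^{torus}·(σ_s A σ_s⁻¹) = σ_s (Δ′_a^{box,s}·A) σ_s⁻¹` — the seam never sees a term supported off the walls.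
[cite: Balaban1984PropagatorsII, (2.38) p.229 with [3] (2.6) p.576, dictionary] -/
theorem mlOpT_mul_reindex (hMh : 1 ≤ Mh) (hP : ∀ i, 1 ≤ P i) (a : ℕ → ℝ) (s : Fin (d + 1) → ℤ)
    {A : Matrix ↥(boxDom (N0 ℓ Mh k P)) ↥(boxDom (N0 ℓ Mh k P)) ℝ}
    (hA : ∀ w, ¬ Interior (N0 ℓ Mh k P) w → ∀ y, A w y = 0) :
    mlOpT (N0 ℓ Mh k P) ℓ k D.lev a
        * Matrix.reindex (tshift (N0 ℓ Mh k P) (B6MultiLevelTorusOperator.TDomains.tvec ℓ Mh k s)) (tshift (N0 ℓ Mh k P) (B6MultiLevelTorusOperator.TDomains.tvec ℓ Mh k s)) A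
      = Matrix.reindex (tshift (N0 ℓ Mh k P) (B6MultiLevelTorusOperator.TDomains.tvec ℓ Mh k s)) (tshift (N0 ℓ Mh k P) (B6MultiLevelTorusOperator.TDomains.tvec ℓ Mh k s))
          (mlOp (N0 ℓ Mh k P) ℓ k (D.chart s).toDomains.lev a * A) := by
  rw [mlOpT_eq_reindex_chart D hMh hP a s]
  simp only [Matrix.reindex_apply, Matrix.submatrix_mul_equiv, Matrix.add_mul, seamT_mul_eq_zero hA, add_zero]

end Chart

end

end Literature.MathematicalPhysics.QuantumFieldTheory.Balaban1983to89.B6MultiLevelTorusOperatorL0
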